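import Literature.Computability.Complexity.F2RowReduction
import Literature.Computability.QuantumComplexity.GaussCodeFP
import HarnessLib

/-!
# Exact Fourier sampling of quadratic phase functions: the sampler, its Gauss sums, polynomial time

Topic `Literature/Computability/QuantumComplexity` (machine-side toolkit of the classical
dequantizer of CUBIC 2-fold Forrelation, route `QuantumAdvantage/CubicForrelation`, items
`CubicForrelationInPrBPP` / old `ExactCubicForrelationNotPrBPP`; mathematics in
`ForrelationDerivativeTables.lean`).

A Boolean function `q : {0,1}ⁿ → {0,1}` is handed to the machine as an EVALUATION ORACLE on bit
lists (in the application `q = D_h a`, the derivative of a cubic `a` computed by a circuit, so that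
`q` is quadratic). From `O(n²)` values of `q` — at `0`, at the unit vectors `eᵢ` and at `eᵢ ⊕ eⱼ` —
the machine reads off the data of the quadratic interpolant
`q̃(x) = c ⊕ ⊕ᵢ ℓᵢ xᵢ ⊕ ⊕_{j<l} B_{lj} x_l x_j` (`cstOf`, `linOf`, `bmatOf`: `c = q(0)`,
`ℓᵢ = q(eᵢ) ⊕ q(0)`, `B_{ij} = q(eᵢ ⊕ eⱼ) ⊕ q(eᵢ) ⊕ q(eⱼ) ⊕ q(0)`, the polar form), and then

* **the exact Walsh coefficient** `T(u) = Σ_x (-1)^{q̃(x) ⊕ u·x}` as the quadratic Gauss sum of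
  Bravyi–Gosset (`gdOf`, `TOf`: `GData` with EVEN phases `μ = 2c`, `Λ = 2(ℓ ⊕ u)`, couplings `B`,
  evaluated by `BravyiGosset.GData.gaussEval`, `CliffordGaussSums.lean`), and
* **the exact Fourier sampler**: the support of `u ↦ T(u)` is the affine subspace
  `u⋆ ⊕ im B` with `u⋆_f = q̃(r_f) ⊕ q(0)` at the free columns `f` of the reduced echelon form of
  `B` (`r_f = kvec f`, `F2RowReduction.lean`) and `0` at the pivot columns (`ustarOf`), so
  `w ↦ u⋆ ⊕ ⊕_{j : w_j} B_j` (`xorSel`, `uOf`) pushes the uniform distribution on `{0,1}ⁿ` to the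
  distribution `T(u)²/4ⁿ` (Dickson's theorem: `|T|` is constant on its support) — the analysis is
  in the sequel; this file has the DEFINITIONS and their `CodeFP` certificates, uniformly in an
  oracle family `Q : σ → List Bool → Bool` computed on codes (`hQ`).

## References

* S. Bravyi, D. Gosset, *Improved classical simulation of quantum circuits dominated by Clifford
  gates*, PRL 116 (2016) 250501, App. A (exponential sums of quadratic forms). [BravyiGosset2016]
* F. J. MacWilliams, N. J. A. Sloane, *The Theory of Error-Correcting Codes*, North-Holland 1977,
  Ch. 15 §2 (Dickson's theorem; weight/Walsh distribution of quadratic forms). [MacWilliamsSloane1977]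
* C. Carlet, *Boolean Functions for Cryptography and Coding Theory*, CUP 2020, §2.2.1 (algebraic
  normal form), §5.2 (quadratic functions, their Walsh spectra). [Carlet2020]
* S. Arora, B. Barak, *Computational Complexity: A Modern Approach*, CUP 2009, §1.3. [AroraBarak2009]
-/

namespace Literature.Computability.QuantumComplexity

namespace QuadSampler

open _root_.Computability Literature.Computability.Complexity Literature.Computability.Complexity.CodeFP
open Literature.Computability.Complexity.F2Elim (bxorL bitsE stCE rrun isPiv kvec)
open BravyiGosset (GData gdE)

/-! ### Vectors -/

/-- The zero vector of length `n`. [folklore] -/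
def zeroL (n : ℕ) : List Bool := List.replicate n false

/-- The unit vector `eᵢ` of length `n`. [folklore] -/
def unitL (n i : ℕ) : List Bool := (List.range n).map fun c => decide (c = i)

/-- The vector `eᵢ ⊕ eⱼ` of length `n` (for `i ≠ j`; `0` for `i = j`). [folklore] -/
def pairL (n i j : ℕ) : List Bool := (List.range n).map fun c => (decide (c = i) ^^ decide (c = j))

/-! ### The interpolation data of an oracle -/

/-- The constant coefficient `c = q(0)`. [cite: Carlet2020, §2.2.1] -/
def cstOf (q : List Bool → Bool) (n : ℕ) : Bool := q (zeroL n)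

/-- The linear coefficients `ℓᵢ = q(eᵢ) ⊕ q(0)`. [cite: Carlet2020, §2.2.1] -/
def linOf (q : List Bool → Bool) (n : ℕ) : List Bool := (List.range n).map fun i => (q (unitL n i) ^^ q (zeroL n))

/-- The polar-form entry `B_{ij} = q(eᵢ ⊕ eⱼ) ⊕ q(eᵢ) ⊕ q(eⱼ) ⊕ q(0)` (`0` on the diagonal).
[cite: Carlet2020, §5.2] -/
def bentry (q : List Bool → Bool) (n i j : ℕ) : Bool :=
  (!decide (i = j)) && ((q (pairL n i j) ^^ q (unitL n i)) ^^ (q (unitL n j) ^^ q (zeroL n)))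

/-- The polar (alternating) matrix `B` of `q`, as `n` rows of `n` bits. [cite: Carlet2020, §5.2] -/
def bmatOf (q : List Bool → Bool) (n : ℕ) : List (List Bool) := (List.range n).map fun i => (List.range n).map fun j => bentry q n i j

/-! ### The sampler -/

/-- The support point `u⋆`: at a free column `f` of the reduced form `S` of `B`, the bit
`q(kvec f) ⊕ q(0)`; `0` at pivot columns. [cite: MacWilliamsSloane1977, Ch. 15 §2] -/
def ustarOf (q : List Bool → Bool) (n : ℕ) (S : List F2Elim.Row) : List Bool :=
  (List.range n).map fun f => (!isPiv S f) && (q (kvec n S f) ^^ q (zeroL n))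

/-- Select-and-xor: `⊕_{j : w_j = 1} M_j` over the rows of `M` (starting from `0ⁿ`). [folklore] -/
def xorSel (n : ℕ) (M : List (List Bool)) (w : List Bool) : List Bool :=
  (List.zipWith (fun r b => if b then r else []) M w).foldl bxorL (zeroL n)

/-- **The sampled frequency** `u = u⋆ ⊕ ⊕_{j : w_j} B_j` from the coins `w`.
[cite: MacWilliamsSloane1977, Ch. 15 §2] -/
def uOf (q : List Bool → Bool) (n : ℕ) (w : List Bool) : List Bool :=
  bxorL (ustarOf q n (rrun n (bmatOf q n))) (xorSel n (bmatOf q n) w)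

/-! ### The Gauss sum -/

/-- An even phase: `2·[b] ∈ ℤ₄`. [folklore] -/
def ph (b : Bool) : ℕ := if b then 2 else 0

/-- The Bravyi–Gosset data of `Σ_x i^{2c + 2(ℓ·x)} (-1)^{Σ_{j<l} B_{lj} x_l x_j} = Σ_x (-1)^{c ⊕ ℓ·x ⊕ B(x)}`.
[cite: BravyiGosset2016, App. A] -/
def gdOf (c : Bool) (lin : List Bool) (B : List (List Bool)) : GData := ⟨ph c, lin.map ph, B⟩

/-- **The Walsh coefficient at `u`** of the quadratic interpolant of `q`, as an exact integer: the
real part of the Gauss sum with linear phases `ℓ ⊕ u` (the sum is real). The `sanitize` is the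
identity on this data (all lists have length `n`, all phases are `< 4`) and is kept to match the
certified evaluator `gaussEval_codeFP` literally. [cite: BravyiGosset2016, App. A] -/
def TOf (q : List Bool → Bool) (n : ℕ) (u : List Bool) : ℤ :=
  (zgOf (GData.gaussEval n (GData.sanitize n (gdOf (cstOf q n) (bxorL (linOf q n) u) (bmatOf q n))))).1

/-- `TOf` is the real part of the Gauss sum. [folklore] -/
theorem TOf_eq_re (q : List Bool → Bool) (n : ℕ) (u : List Bool) :
    TOf q n u = (GData.gaussEval n (GData.sanitize n (gdOf (cstOf q n) (bxorL (linOf q n) u) (bmatOf q n)))).re := rfl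

/-! ### Polynomial time, uniformly in an oracle family computed on codes -/

section Code

variable {σ : Type} {eσ : σ → List Bool} {Q : σ → List Bool → Bool}

/-- The zero vector on codes (`n` unary). [folklore] -/
theorem zeroL_codeFP : CodeFP unE bitsE zeroL :=
  ((replicateOf bitE).comp ((const _ false).pair (CodeFP.id _))).congr fun _ => rfl

/-- Unit vectors on codes. [folklore] -/
theorem unitL_codeFP : CodeFP (pairE unE natE) bitsE (fun p => unitL p.1 p.2) := by
  have hm := CodeFP.map (σ := ℕ) (eσ := natE) (eα := natE) (eβ := bitE) (g := fun t => decide (t.2 = t.1))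
    (natEq.comp ((snd _ _).pair (fst _ _)))
  exact (hm.comp ((snd _ _).pair (urange.comp (fst _ _)))).congr fun _ => rfl

/-- The vectors `eᵢ ⊕ eⱼ` on codes. [folklore] -/
theorem pairL_codeFP : CodeFP (pairE unE (pairE natE natE)) bitsE (fun p => pairL p.1 p.2.1 p.2.2) := by
  have hm := CodeFP.map (σ := ℕ × ℕ) (eσ := pairE natE natE) (eα := natE) (eβ := bitE)
    (g := fun t => (decide (t.2 = t.1.1) ^^ decide (t.2 = t.1.2)))
    ((natEq.comp ((snd _ _).pair (fst _ _).fst')).xor (natEq.comp ((snd _ _).pair (fst _ _).snd')))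
  exact (hm.comp ((snd _ _).pair (urange.comp (fst _ _)))).congr fun _ => rfl

variable (hQ : CodeFP (pairE eσ bitsE) bitE (fun t => Q t.1 t.2))
include hQ

/-- The constant coefficient on codes. [cite: AroraBarak2009, §1.3] -/
theorem cstOf_codeFP : CodeFP (pairE eσ unE) bitE (fun t => cstOf (Q t.1) t.2) :=
  hQ.comp ((fst _ _).pair (zeroL_codeFP.comp (snd _ _)))

/-- The linear coefficients on codes. [cite: AroraBarak2009, §1.3] -/
theorem linOf_codeFP : CodeFP (pairE eσ unE) bitsE (fun t => linOf (Q t.1) t.2) := by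
  -- item map with context `(s, n)`: `i ↦ Q s (unitL n i) ^^ Q s (zeroL n)`
  have hg : CodeFP (pairE (pairE eσ unE) natE) bitE (fun t => (Q t.1.1 (unitL t.1.2 t.2) ^^ Q t.1.1 (zeroL t.1.2))) :=
    (hQ.comp ((fst _ _).fst'.pair (unitL_codeFP.comp ((fst _ _).snd'.pair (snd _ _))))).xor
      (hQ.comp ((fst _ _).fst'.pair (zeroL_codeFP.comp (fst _ _).snd')))
  have hm := CodeFP.map (σ := σ × ℕ) (eσ := pairE eσ unE) (eα := natE) (eβ := bitE)
    (g := fun t => (Q t.1.1 (unitL t.1.2 t.2) ^^ Q t.1.1 (zeroL t.1.2))) hg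
  exact (hm.comp ((CodeFP.id _).pair (urange.comp (snd _ _)))).congr fun _ => rfl

/-- One polar entry on codes: `((s, n), (i, j)) ↦ bentry (Q s) n i j`. [cite: AroraBarak2009, §1.3] -/
theorem bentry_codeFP : CodeFP (pairE (pairE eσ unE) (pairE natE natE)) bitE (fun t => bentry (Q t.1.1) t.1.2 t.2.1 t.2.2) := by
  have hs : CodeFP (pairE (pairE eσ unE) (pairE natE natE)) eσ (fun t => t.1.1) := (fst _ _).fst'
  have hn : CodeFP (pairE (pairE eσ unE) (pairE natE natE)) unE (fun t => t.1.2) := (fst _ _).snd'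
  have hi : CodeFP (pairE (pairE eσ unE) (pairE natE natE)) natE (fun t => t.2.1) := (snd _ _).fst'
  have hj : CodeFP (pairE (pairE eσ unE) (pairE natE natE)) natE (fun t => t.2.2) := (snd _ _).snd'
  have h1 := hQ.comp (hs.pair (pairL_codeFP.comp (hn.pair (hi.pair hj))))
  have h2 := hQ.comp (hs.pair (unitL_codeFP.comp (hn.pair hi)))
  have h3 := hQ.comp (hs.pair (unitL_codeFP.comp (hn.pair hj)))
  have h4 := hQ.comp (hs.pair (zeroL_codeFP.comp hn))
  exact ((natEq.comp (hi.pair hj)).not.and ((h1.xor h2).xor (h3.xor h4))).congr fun _ => rfl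

/-- The polar matrix on codes. [cite: AroraBarak2009, §1.3] -/
theorem bmatOf_codeFP : CodeFP (pairE eσ unE) (rawE bitsE) (fun t => bmatOf (Q t.1) t.2) := by
  -- inner map: context `((s, n), i)`, item `j`
  have hin := CodeFP.map (σ := (σ × ℕ) × ℕ) (eσ := pairE (pairE eσ unE) natE) (eα := natE) (eβ := bitE)
    (g := fun t => bentry (Q t.1.1.1) t.1.1.2 t.1.2 t.2) ((bentry_codeFP hQ).comp ((fst _ _).fst'.pair ((fst _ _).snd'.pair (snd _ _))))
  have hrow : CodeFP (pairE (pairE eσ unE) natE) bitsE (fun t => (List.range t.1.2).map fun j => bentry (Q t.1.1) t.1.2 t.2 j) :=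
    (hin.comp ((CodeFP.id _).pair (urange.comp (fst _ _).snd'))).congr fun _ => rfl
  have hout := CodeFP.map (σ := σ × ℕ) (eσ := pairE eσ unE) (eα := natE) (eβ := bitsE)
    (g := fun t => (List.range t.1.2).map fun j => bentry (Q t.1.1) t.1.2 t.2 j) hrow
  exact (hout.comp ((CodeFP.id _).pair (urange.comp (snd _ _)))).congr fun _ => rfl

/-- The support point on codes: `((s, n), S) ↦ ustarOf (Q s) n S`. [cite: AroraBarak2009, §1.3] -/
theorem ustarOf_codeFP : CodeFP (pairE (pairE eσ unE) stCE) bitsE (fun t => ustarOf (Q t.1.1) t.1.2 t.2) := by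
  -- item map: context `((s, n), S)`, item `f`
  have hs : CodeFP (pairE (pairE (pairE eσ unE) stCE) natE) eσ (fun t => t.1.1.1) := (fst _ _).fst'.fst'
  have hn : CodeFP (pairE (pairE (pairE eσ unE) stCE) natE) unE (fun t => t.1.1.2) := (fst _ _).fst'.snd'
  have hS : CodeFP (pairE (pairE (pairE eσ unE) stCE) natE) stCE (fun t => t.1.2) := (fst _ _).snd'
  have hf : CodeFP (pairE (pairE (pairE eσ unE) stCE) natE) natE (fun t => t.2) := snd _ _
  have hk : CodeFP (pairE (pairE (pairE eσ unE) stCE) natE) bitsE (fun t => kvec t.1.1.2 t.1.2 t.2) :=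
    F2Elim.kvec_codeFP.comp ((hn.pair hf).pair hS)
  have hg : CodeFP (pairE (pairE (pairE eσ unE) stCE) natE) bitE
      (fun t => (!isPiv t.1.2 t.2) && (Q t.1.1.1 (kvec t.1.1.2 t.1.2 t.2) ^^ Q t.1.1.1 (zeroL t.1.1.2))) :=
    (F2Elim.isPiv_codeFP.comp (hf.pair hS)).not.and ((hQ.comp (hs.pair hk)).xor (hQ.comp (hs.pair (zeroL_codeFP.comp hn))))
  have hm := CodeFP.map (σ := (σ × ℕ) × List F2Elim.Row) (eσ := pairE (pairE eσ unE) stCE) (eα := natE) (eβ := bitE)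
    (g := fun t => (!isPiv t.1.2 t.2) && (Q t.1.1.1 (kvec t.1.1.2 t.1.2 t.2) ^^ Q t.1.1.1 (zeroL t.1.1.2))) hg
  exact (hm.comp ((CodeFP.id _).pair (urange.comp (fst _ _).snd'))).congr fun _ => rfl

omit hQ in
/-- Select-and-xor on codes: `(n, (M, w)) ↦ xorSel n M w`. [cite: AroraBarak2009, §1.3 (bounded loops)] -/
theorem xorSel_codeFP : CodeFP (pairE unE (pairE (rawE bitsE) bitsE)) bitsE (fun t => xorSel t.1 t.2.1 t.2.2) := by
  have hz := CodeFP.zipWith (σ := Unit) (eσ := unitE) (eα := bitsE) (eβ := bitE) (eγ := bitsE)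
    (g := fun t => if t.2.2 then t.2.1 else []) (((snd _ _).snd'.ite (snd _ _).fst' (const _ [])).congr fun _ => rfl)
  have hsel : CodeFP (pairE unE (pairE (rawE bitsE) bitsE)) (rawE bitsE)
      (fun t => List.zipWith (fun r b => if b then r else []) t.2.1 t.2.2) :=
    (hz.comp ((const _ ()).pair (snd _ _))).congr fun _ => rfl
  have hfold := CodeFP.foldl (σ := ℕ) (α := List Bool) (β := List Bool) (eσ := unE) (eα := bitsE) (eβ := bitsE)
    (step := fun _ r acc => bxorL acc r) (init := zeroL) (F2Elim.bxorL_codeFP.comp ((snd _ _).snd'.pair (snd _ _).fst'))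
    zeroL_codeFP (4 * Polynomial.X) (fun n l₁ l₂ => by
      -- the accumulator is no longer than `max n (longest row)`, and a bit list of length `L` has code `4L`
      have hlen : ∀ (l : List (List Bool)) (acc : List Bool), (∀ r ∈ l, r.length ≤ acc.length) →
          (l.foldl (fun acc r => bxorL acc r) acc).length = acc.length := by
        intro l
        induction l with
        | nil => intro acc _; rfl
        | cons r l ih =>
          intro acc h
          rw [List.foldl_cons, ih]
          · rw [F2Elim.length_bxorL, max_eq_left (h r List.mem_cons_self)]
          · intro r' hr'
            rw [F2Elim.length_bxorL]
            exact le_max_of_le_left (h r' (List.mem_cons_of_mem _ hr'))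
      have hmono : ∀ (l : List (List Bool)) (acc acc' : List Bool), acc.length ≤ acc'.length →
          (l.foldl (fun acc r => bxorL acc r) acc).length ≤ (l.foldl (fun acc r => bxorL acc r) acc').length := by
        intro l
        induction l with
        | nil => intro acc acc' h; exact h
        | cons r l ih =>
          intro acc acc' h
          rw [List.foldl_cons, List.foldl_cons]
          exact ih _ _ (by rw [F2Elim.length_bxorL, F2Elim.length_bxorL]; exact max_le_max h le_rfl)
      have hcode : ∀ v : List Bool, (bitsE v).length = 4 * v.length := fun v => by
        simp only [bitsE, length_rawE, bitE, List.length_singleton, List.map_const', List.sum_replicate, smul_eq_mul]; ring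
      -- bound the run from `zeroL n` by the run from a longer all-purpose accumulator
      set L := (pairE unE (rawE bitsE) (n, l₁ ++ l₂)).length with hL
      have hLeq : L = 2 * n + 2 + (rawE bitsE (l₁ ++ l₂)).length := by
        simp only [hL, pairE_apply, length_boolPair, length_unE]
      have hrow : ∀ r ∈ l₁, r.length ≤ L := by
        intro r hr
        have h1 := length_item_le_length_rawE bitsE (List.mem_append_left l₂ hr)
        rw [hcode] at h1
        omega
      have hnL : n ≤ L := by omega
      have key := hmono l₁ (zeroL n) (List.replicate L false) (by simp [zeroL, hnL])
      rw [hlen l₁ (List.replicate L false) (by simpa using hrow), List.length_replicate] at key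
      rw [hcode, Polynomial.eval_mul, Polynomial.eval_ofNat, Polynomial.eval_X]
      exact Nat.mul_le_mul_left 4 key)
  exact (hfold.comp ((fst _ _).pair hsel)).congr fun _ => rfl

/-- **The sampled frequency on codes**: `((s, n), w) ↦ uOf (Q s) n w`. [cite: AroraBarak2009, §1.3] -/
theorem uOf_codeFP : CodeFP (pairE (pairE eσ unE) bitsE) bitsE (fun t => uOf (Q t.1.1) t.1.2 t.2) := by
  have hB : CodeFP (pairE (pairE eσ unE) bitsE) (rawE bitsE) (fun t => bmatOf (Q t.1.1) t.1.2) := (bmatOf_codeFP hQ).comp (fst _ _)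
  have hn : CodeFP (pairE (pairE eσ unE) bitsE) unE (fun t => t.1.2) := (fst _ _).snd'
  have hS : CodeFP (pairE (pairE eσ unE) bitsE) stCE (fun t => rrun t.1.2 (bmatOf (Q t.1.1) t.1.2)) :=
    F2Elim.rrun_codeFP.comp (hn.pair hB)
  have hu : CodeFP (pairE (pairE eσ unE) bitsE) bitsE (fun t => ustarOf (Q t.1.1) t.1.2 (rrun t.1.2 (bmatOf (Q t.1.1) t.1.2))) :=
    (ustarOf_codeFP hQ).comp ((fst _ _).pair hS)
  have hx : CodeFP (pairE (pairE eσ unE) bitsE) bitsE (fun t => xorSel t.1.2 (bmatOf (Q t.1.1) t.1.2) t.2) :=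
    xorSel_codeFP.comp (hn.pair (hB.pair (snd _ _)))
  exact (F2Elim.bxorL_codeFP.comp (hu.pair hx)).congr fun _ => rfl

omit hQ in
/-- Even phases on codes. [folklore] -/
theorem ph_codeFP : CodeFP bitE natE ph :=
  ((CodeFP.id bitE).ite (const _ 2) (const _ 0)).congr fun b => by cases b <;> rfl

omit hQ in
/-- The Gauss-sum data on codes. [cite: AroraBarak2009, §1.3] -/
theorem gdOf_codeFP : CodeFP (pairE bitE (pairE bitsE (rawE bitsE))) gdE (fun t => gdOf t.1 t.2.1 t.2.2) := by
  have h1 : CodeFP (pairE bitE (pairE bitsE (rawE bitsE))) natE (fun t => ph t.1) := ph_codeFP.comp (fst _ _)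
  have h2 : CodeFP (pairE bitE (pairE bitsE (rawE bitsE))) BravyiGosset.natsE (fun t => t.2.1.map ph) :=
    (map₀ ph_codeFP).comp (snd _ _).fst'
  have h3 : CodeFP (pairE bitE (pairE bitsE (rawE bitsE))) BravyiGosset.rowsE (fun t => t.2.2) := (snd _ _).snd'
  have h := BravyiGosset.gdMk.comp (h1.pair (h2.pair h3))
  exact h.congr fun _ => rfl

/-- **The exact Walsh coefficient on codes**: `((s, n), u) ↦ TOf (Q s) n u` (through the certified
quadratic Gauss-sum evaluator `gaussEval_codeFP`). [cite: BravyiGosset2016, App. A] -/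
theorem TOf_codeFP : CodeFP (pairE (pairE eσ unE) bitsE) intE (fun t => TOf (Q t.1.1) t.1.2 t.2) := by
  have hsn : CodeFP (pairE (pairE eσ unE) bitsE) (pairE eσ unE) (fun t => t.1) := fst _ _
  have hc : CodeFP (pairE (pairE eσ unE) bitsE) bitE (fun t => cstOf (Q t.1.1) t.1.2) := (cstOf_codeFP hQ).comp hsn
  have hl : CodeFP (pairE (pairE eσ unE) bitsE) bitsE (fun t => bxorL (linOf (Q t.1.1) t.1.2) t.2) :=
    F2Elim.bxorL_codeFP.comp (((linOf_codeFP hQ).comp hsn).pair (snd _ _))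
  have hB : CodeFP (pairE (pairE eσ unE) bitsE) (rawE bitsE) (fun t => bmatOf (Q t.1.1) t.1.2) := (bmatOf_codeFP hQ).comp hsn
  -- (no expected types below: unifying the stated functions with the inferred ones is slow)
  have hD := gdOf_codeFP.comp (hc.pair (hl.pair hB))
  have hG := BravyiGosset.gaussEval_codeFP.comp (hsn.snd'.pair hD)
  refine hG.fst'.congr fun t => ?_
  dsimp only [TOf]

end Code

end QuadSampler

end Literature.Computability.QuantumComplexity
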